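import Summits.SmoothPoincare4.SmoothPoincare4.Theses.WeylBudget
import Literature.Geometry.Lorentzian.LeviCivitaProofs
import Literature.Geometry.Riemannian.WarpedSeamMetric
import HarnessLib

/-!
# Bridge sub-goal T1 of crux `CorkRegluingBudget` (line `registered`, RESHAPE 3): the warped
# symmetric tube metric `ψ(t) ĥ ⊕ dt²` on `Y × ℝ`

Registered sub-goal `bridge_warpedTube_metric` of `stub_warpedBridge` (item
stmt-SmoothPoincare4-10831).  For a closed 3-manifold `Y`, a Riemannian metric `ĥ` on `Y` invariant
under a diffeomorphism `τ` (`τ^* ĥ = ĥ`) and a smooth positive profile `ψ : ℝ → ℝ`, the warped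
product `G = ψ(t) ĥ ⊕ dt²` on the product manifold `Y × ℝ` (model `(𝓡 3).prod 𝓘(ℝ, ℝ)`) is a
`C^∞` Riemannian metric with Levi-Civita connection, `G_{(z,t)}((V₁,V₂),(W₁,W₂)) =
ψ(t) ĥ_z(V₁,W₁) + V₂ W₂`, and `(z, t) ↦ (τ z, t)` is an isometry of `G`.  Proof: the tree's warped
seam metric `a · pr₂^* dt² + F · pr₁^* ĥ` (`exists_warpedSeamMetric`, O'Neill 1983, Ch. 7,
Def. 7.33) with `a ≡ 1`, `F(z, t) = ψ(t)`; the Levi-Civita connection by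
`PseudoRiemannianMetric.hasLeviCivita`; invariance under `τ × id` by `warpedSeam_val_prodMap`.
Everything here is proved; no definitions, no facts.
-/

set_option linter.dupNamespace false

open scoped Manifold ContDiff Topology
open Set Function

noncomputable section

namespace Summit.SmoothPoincare4.SmoothPoincare4.Theorems.CorkRegluingBudget

/-- **T1 — the warped symmetric tube metric** (sub-goal `bridge_warpedTube_metric` of
`stub_warpedBridge`, crux `CorkRegluingBudget`, line `registered` RESHAPE 3).  Over a closed
Riemannian 3-manifold `(Y, ĥ)` with `τ^* ĥ = ĥ`, for every smooth positive profile `ψ` the warped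
product `G = ψ(t) ĥ ⊕ dt²` on `Y × ℝ` (model `(𝓡 3).prod 𝓘(ℝ, ℝ)`) is a smooth Riemannian metric
with Levi-Civita connection, with the displayed value, for which `(z, t) ↦ (τ z, t)` is an
isometry. [cite: ONeill1983, Ch. 7, Def. 7.33 and Prop. 7.35] -/
theorem bridge_warpedTube_metric :
    ∀ (Y : Type) [TopologicalSpace Y] [T2Space Y] [SecondCountableTopology Y] [CompactSpace Y]
      [ChartedSpace (EuclideanSpace ℝ (Fin 3)) Y] [IsManifold (𝓡 3) ∞ Y]
      (ĥ : Literature.Geometry.Lorentzian.PseudoRiemannianMetric (𝓡 3) ∞ (EuclideanSpace ℝ (Fin 3))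
        (TangentSpace (𝓡 3) : Y → Type _)) [ĥ.HasLeviCivita]
      (τ : Y ≃ₘ⟮𝓡 3, 𝓡 3⟯ Y) (ψ : ℝ → ℝ),
      ĥ.IsRiemannian →
      (∀ z, Literature.Geometry.Lorentzian.pullbackBilin (I := 𝓡 3) (I' := 𝓡 3) τ ĥ.val z = ĥ.val z) →
      ContDiff ℝ ∞ ψ → (∀ t, 0 < ψ t) →
      ∃ (G : Literature.Geometry.Lorentzian.PseudoRiemannianMetric ((𝓡 3).prod 𝓘(ℝ, ℝ)) ∞
          (EuclideanSpace ℝ (Fin 3) × ℝ) (TangentSpace ((𝓡 3).prod 𝓘(ℝ, ℝ)) : Y × ℝ → Type _))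
        (_ : G.HasLeviCivita),
        G.IsRiemannian ∧
        (∀ (p : Y × ℝ) (V W : TangentSpace ((𝓡 3).prod 𝓘(ℝ, ℝ)) p),
          G.val p V W = ψ p.2 * ĥ.val p.1 V.1 W.1 + V.2 * W.2) ∧
        (∀ p : Y × ℝ, Literature.Geometry.Lorentzian.pullbackBilin (I := (𝓡 3).prod 𝓘(ℝ, ℝ))
          (I' := (𝓡 3).prod 𝓘(ℝ, ℝ)) (fun q : Y × ℝ ↦ (τ q.1, q.2)) G.val p = G.val p) := by
  intro Y _ _ _ _ _ _ ĥ _ τ ψ hRiem hτ hψ hψpos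
  -- the warped seam metric `1 · pr₂^* dt² + ψ(t) · pr₁^* ĥ` of `WarpedSeamMetric.lean`
  obtain ⟨G, hGR, hG⟩ := Literature.Geometry.Riemannian.exists_warpedSeamMetric (I' := 𝓡 3) ĥ
    hRiem (a := fun _ : Y × ℝ ↦ (1 : ℝ)) (F := fun p : Y × ℝ ↦ ψ p.2) contMDiff_const
    (hψ.comp_contMDiff contMDiff_snd) (fun _ ↦ one_pos) (fun p ↦ hψpos p.2)
  refine ⟨G, G.hasLeviCivita, hGR, fun p V W ↦ ?_, fun p ↦ ?_⟩
  · rw [hG]; ring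
  · ext V W
    exact Literature.Geometry.Riemannian.warpedSeam_val_prodMap hG
      ((τ.mdifferentiable (by simp)) p.1) (hτ p.1) rfl rfl V W

end Summit.SmoothPoincare4.SmoothPoincare4.Theorems.CorkRegluingBudget

end

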